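import Summits.NavierStokesRegularity.NavierStokesRegularity.Theorems.SelfMixingDichotomyCoherentScaleExclusionStructure
import Summits.NavierStokesRegularity.NavierStokesRegularity.Theorems.SelfMixingDichotomyCoherentScaleExclusionTypeIRateCeiling
import Summits.NavierStokesRegularity.NavierStokesRegularity.Theorems.SelfMixingDichotomyLocalToGlobal
import Summits.NavierStokesRegularity.NavierStokesRegularity.Theorems.PlaneEnergyCeilingBoundedPlanarEnergyRegularityLocalClayTheory
import Summits.NavierStokesRegularity.NavierStokesRegularity.Theses.TypeIIInviscidRelaxation
import Literature.Analysis.FluidPDE.TypeIRateScaledEnergyBound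
import HarnessLib

/-!
# Route SelfMixingDichotomy — crux `CoherentScaleExclusion` (S2, item stmt-NavierStokesRegularity-1423):
# the Type-II regimes are dominated by Type-II exclusion

Helper file of the crux item (lands `--supports stmt-NavierStokesRegularity-1423`; line `registered`,
lead c5). Write `C(r) = cknC r (T,x₀) u` for the centred scaled cubic load of a STANDING solution
(`ν = 1`, classical on `ℝ³ × [0,T)`, Leray–Hopf on `[0,T]`, rapidly decaying datum).

The lossless cut of S2 into the regimes of the load profile `r ↦ C(r)` at a final-time point
(`coherentScaleExclusion_of_regimes`, file `…Structure`) has the three registered stubs (A) ceiling,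
(I) windows with unbounded load, (B) pure cascade `C → ∞`. Regimes (A) and (I) are dominated by the
sibling crux S1 (file `…Structure`) and (A) by `¬ TypeISingularityExists` (file `…TypeIRegime`).

THIS FILE: regimes (I) and (B) — in particular the core stub B, which five leads handed back as
crux-sized — are dominated by the Type-II exclusion statement of route `TypeIIInviscidRelaxation`,
`NoTypeII` (item stmt-NavierStokesRegularity-0056: a maximal smooth solution from a rapidly decaying
Leray–Hopf datum blows up at the `L∞` Type-I rate `‖u(t)‖_∞ ≤ C (T−t)^{-1/2}`), taken BY NAME as a
hypothesis (the route file `Theses.TypeIIInviscidRelaxation` is imported for its name only). The mechanism is the printed fact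

> Seregin 2014 (Lecture Notes), Prop. 3.11 (i), case `G₂` (= Seregin, ICM 2010, Prop. 1.3 (i);
> proof: Seregin–Šverák 2009, Lemma 3.5): for a suitable weak solution, the rate
> `sup_Q √(−t)|v| < ∞` bounds `sup_r (A + C + D + E)(r)` at the vertex,

PROVED in the tree for general suitable weak solutions
(`Literature.Analysis.FluidPDE.scaledEnergies_bounded_of_typeIRate`) and bridged to standing
solutions by the registered stub `stub_cknC_ceiling_of_isTypeIBlowup` (file `…TypeIRateCeiling`):
an `L∞`-Type-I blow-up has a centred cubic CEILING at every point, so a point with unbounded load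
(regimes I, B) is not a point of an `L∞`-Type-I blow-up; under `NoTypeII` the solution then extends
smoothly past `T` and is bounded near the point — contradiction with unbounded load. Coherence
(`¬ MIX`) is not used, exactly as in the S1-dominations.

## Contents

* `cknC_ceiling_of_isTypeIBlowup` — standing + `IsTypeIBlowup u T` ⇒ `C(r) ≤ M₁` near `0` at every
  `x₀` (composition of the stub with the Literature theorem).
* `not_isTypeIBlowup_of_unboundedLoad` — contrapositive: unbounded centred load at one point
  certifies that the blow-up (if any) is not of `L∞` Type I.
* `cknC_ceiling_of_noTypeII` — under `NoTypeII`, EVERY standing solution has a load ceiling at every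
  final-time point (extension ⇒ bounded ⇒ ceiling; maximal ⇒ Type-I rate ⇒ ceiling).
* `coherentWindowRegime_of_noTypeII : NoTypeII → (I)`, `coherentCascadeRegime_of_noTypeII :
  NoTypeII → (B)` — the registered stubs I and B as CONCLUSIONS.
* `coherentScaleExclusion_of_noTypeII_of_sequentialTypeIExclusion : NoTypeII → S1 → S2`,
  `coherentScaleExclusion_of_noTypeII_of_not_typeISingularityExists : NoTypeII → ¬TISE → S2`.
* `isBackwardBoundedAt_of_isTypeIBlowup_of_sequentialTypeIExclusion`,
  `hasSmoothExtensionPast_of_isTypeIBlowup_of_sequentialTypeIExclusion` — S1 ALONE bars every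
  `L∞`-Type-I blow-up of a standing solution (sharpening `bdd_of_typeI_of_sequentialTypeIExclusion_of_
  coherentScaleExclusion` of file `…NonMixingExclusion`, which needed S2 as well): S1 implies the
  `ν = 1` instance of `NoTypeIBlowup` (item stmt-NavierStokesRegularity-1217).
* `navierStokesRegularity_of_sequentialTypeIExclusion_of_noTypeII : S1 → NoTypeII →
  NavierStokesRegularity` — modulo S1 the pair (MixingPayoff, CoherentScaleExclusion) of this route is
  a WEAKENING of Type-II exclusion: the route's deciding theorem with (P, S2) replaced by NoTypeII.

## References

* G. Seregin, *Lecture Notes on Regularity Theory for the Navier–Stokes Equations*, World Scientific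
  (2014), Ch. 6 §6.3, Prop. 3.11 (i). [Seregin2014]
* G. Seregin, V. Šverák, Comm. PDE 34 (2009) 171–201 = arXiv:0804.1803, Lemma 3.5. [SereginSverak2009]
-/

noncomputable section

namespace Summit.NavierStokesRegularity.NavierStokesRegularity.Theorems

set_option linter.dupNamespace false

open MeasureTheory Filter Set Metric Function TopologicalSpace Topology
open scoped ENNReal NNReal
open Literature.Analysis.FluidPDE
open Summit.NavierStokesRegularity.NavierStokesRegularity.Theses.SelfMixingDichotomy

/-! ### The centred cubic ceiling of an `L∞`-Type-I blow-up -/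

/-- **An `L∞`-Type-I blow-up has a centred cubic ceiling at every point.** For a standing solution
(`ν = 1`, classical on `[0,T)`, Leray–Hopf, rapidly decaying datum) with `IsTypeIBlowup u T`
(`‖u(t,x)‖ ≤ C/√(T−t)` for all `x` and all `t < T` near `T`) and every `x₀` there are `M₁` and
`r₁ > 0` with `cknC r (T,x₀) u ≤ ofReal M₁` for `0 < r < r₁`: the registered bridge
`stub_cknC_ceiling_of_isTypeIBlowup` fed with Seregin's Prop. 3.11 (i)
(`scaledEnergies_bounded_of_typeIRate`). [cite: Seregin2014, Ch. 6 §6.3 Prop. 3.11 (i)] -/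
theorem cknC_ceiling_of_isTypeIBlowup {T : ℝ} (hT : 0 < T)
    {u : ℝ → EuclideanSpace ℝ (Fin 3) → EuclideanSpace ℝ (Fin 3)} {p : ℝ → EuclideanSpace ℝ (Fin 3) → ℝ}
    (hcl : IsClassicalNSSolutionOn (Set.Ico 0 T) 1 0 u p) (hLH : IsLerayHopfOn T 1 0 (u 0) u)
    (hdec : HasRapidSpatialDecay (u 0)) (hI : IsTypeIBlowup u T) (x₀ : EuclideanSpace ℝ (Fin 3)) :
    ∃ M₁ r₁ : ℝ, 0 < r₁ ∧ ∀ r ∈ Set.Ioo 0 r₁,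
      cknC r ((T, x₀) : ℝ × EuclideanSpace ℝ (Fin 3)) u ≤ ENNReal.ofReal M₁ :=
  stub_cknC_ceiling_of_isTypeIBlowup
    (fun _Q _v _q _G hsw hG _z _r₀ hr₀ hQ hC hD hrate =>
      scaledEnergies_bounded_of_typeIRate hsw hG hr₀ hQ hC hD hrate)
    T hT u p hcl hLH hdec hI x₀

/-- **Unbounded centred load certifies a Type-II rate.** If at some `x₀` the scaled cubic load of a
standing solution is unbounded along `r → 0` (`∀ M r₁, ∃ r < r₁, ofReal M < cknC r (T,x₀) u` — regimes
(I) and (B) of the crux), then `u` does NOT blow up at the `L∞` Type-I rate at `T`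
(contrapositive of `cknC_ceiling_of_isTypeIBlowup`). [cite: Seregin2014, Ch. 6 §6.3 Prop. 3.11 (i)] -/
theorem not_isTypeIBlowup_of_unboundedLoad {T : ℝ} (hT : 0 < T)
    {u : ℝ → EuclideanSpace ℝ (Fin 3) → EuclideanSpace ℝ (Fin 3)} {p : ℝ → EuclideanSpace ℝ (Fin 3) → ℝ}
    (hcl : IsClassicalNSSolutionOn (Set.Ico 0 T) 1 0 u p) (hLH : IsLerayHopfOn T 1 0 (u 0) u)
    (hdec : HasRapidSpatialDecay (u 0)) {x₀ : EuclideanSpace ℝ (Fin 3)}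
    (hunb : ∀ M r₁ : ℝ, 0 < r₁ → ∃ r ∈ Set.Ioo 0 r₁,
      ENNReal.ofReal M < cknC r ((T, x₀) : ℝ × EuclideanSpace ℝ (Fin 3)) u) :
    ¬ IsTypeIBlowup u T := by
  intro hI
  obtain ⟨M₁, r₁, hr₁, hC⟩ := cknC_ceiling_of_isTypeIBlowup hT hcl hLH hdec hI x₀
  obtain ⟨r, hr, hlt⟩ := hunb M₁ r₁ hr₁
  exact absurd (hC r hr) (not_le.2 hlt)

/-! ### Under Type-II exclusion every standing solution has a load ceiling everywhere -/

/-- **Load ceiling under `NoTypeII`.** Assume the Type-II exclusion statement of route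
`TypeIIInviscidRelaxation` (item stmt-NavierStokesRegularity-0056, `NoTypeII`, by name). Then every standing
solution has, at every `x₀`, a centred cubic ceiling `cknC r (T,x₀) u ≤ ofReal M₁` for `0 < r < r₁`:
if `u` extends smoothly past `T` it is bounded near `(T,x₀)`
(`isBackwardBoundedAt_of_hasSmoothExtensionPast`) and `coherentScaleExclusion_loadCeiling_of_bdd`
applies; otherwise `(u,p)` is maximal, `NoTypeII` gives the `L∞` Type-I rate, and
`cknC_ceiling_of_isTypeIBlowup` applies. [folklore] -/
theorem cknC_ceiling_of_noTypeII
    (hNT : Summit.NavierStokesRegularity.NavierStokesRegularity.Theses.TypeIIInviscidRelaxation.NoTypeII)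
    {T : ℝ} (hT : 0 < T)
    {u : ℝ → EuclideanSpace ℝ (Fin 3) → EuclideanSpace ℝ (Fin 3)} {p : ℝ → EuclideanSpace ℝ (Fin 3) → ℝ}
    (hcl : IsClassicalNSSolutionOn (Set.Ico 0 T) 1 0 u p) (hLH : IsLerayHopfOn T 1 0 (u 0) u)
    (hdec : HasRapidSpatialDecay (u 0)) (x₀ : EuclideanSpace ℝ (Fin 3)) :
    ∃ M₁ r₁ : ℝ, 0 < r₁ ∧ ∀ r ∈ Set.Ioo 0 r₁,
      cknC r ((T, x₀) : ℝ × EuclideanSpace ℝ (Fin 3)) u ≤ ENNReal.ofReal M₁ := by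
  by_cases hext : HasSmoothExtensionPast 1 0 u T
  · obtain ⟨ρ, hρ, K, hK⟩ :=
      PlaneEnergyCeilingBoundedPlanarEnergyRegularity.isBackwardBoundedAt_of_hasSmoothExtensionPast hT hext x₀
    exact coherentScaleExclusion_loadCeiling_of_bdd ⟨ρ, hρ, K, hK⟩
  · exact cknC_ceiling_of_isTypeIBlowup hT hcl hLH hdec
      (hNT 1 T one_pos hT u p ⟨hcl, hext⟩ hLH hdec) x₀

/-! ### The registered stubs I and B as consequences of `NoTypeII` -/

/-- **Regime (I) of the crux `CoherentScaleExclusion` (the statement of the registered stub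
`stub_coherentWindowExclusion`, for EVERY `δ > 0`) follows from `NoTypeII`** (item
stmt-NavierStokesRegularity-0056, by name as hypothesis), with `M := 0` and without using the
windows, the recurrence or the coherence: the load ceiling of `cknC_ceiling_of_noTypeII` contradicts
the unbounded-load hypothesis. [folklore] -/
theorem coherentWindowRegime_of_noTypeII
    (hNT : Summit.NavierStokesRegularity.NavierStokesRegularity.Theses.TypeIIInviscidRelaxation.NoTypeII) :
    ∀ δ : ℝ, 0 < δ → ∃ M : ℝ, ∀ T : ℝ, 0 < T → ∀ (u : ℝ → EuclideanSpace ℝ (Fin 3) → EuclideanSpace ℝ (Fin 3)) (p : ℝ → EuclideanSpace ℝ (Fin 3) → ℝ), Literature.Analysis.FluidPDE.IsClassicalNSSolutionOn (Set.Ico 0 T) 1 0 u p → Literature.Analysis.FluidPDE.IsLerayHopfOn T 1 0 (u 0) u → Literature.Analysis.FluidPDE.HasRapidSpatialDecay (u 0) → ∀ x₀ : EuclideanSpace ℝ (Fin 3), (∃ M' : ℝ, ∀ r₁ : ℝ, 0 < r₁ → ∃ r ∈ Set.Ioo 0 r₁, Literature.Analysis.FluidPDE.cknC r ((T, x₀)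 : ℝ × EuclideanSpace ℝ (Fin 3)) u ≤ ENNReal.ofReal M') → (∀ M'' r₁ : ℝ, 0 < r₁ → ∃ r ∈ Set.Ioo 0 r₁, ENNReal.ofReal M'' < Literature.Analysis.FluidPDE.cknC r ((T, x₀) : ℝ × EuclideanSpace ℝ (Fin 3)) u) → (∀ r₀ : ℝ, 0 < r₀ → ∃ r ∈ Set.Ioo 0 r₀, ENNReal.ofReal M ≤ Literature.Analysis.FluidPDE.cknC r ((T, x₀) : ℝ × EuclideanSpace ℝ (Fin 3)) u ∧ ¬ (∀ θ : ℝ → EuclideanSpace ℝ (Fin 3) → ℝ, Literature.Analysis.FluidPDE.IsSmoothSpaceTimeOn (Set.Icc (T - r ^ 2) (T - r ^ 2 / 2)) θ → Literature.Analysis.FluidPDE.HasUniformRapidDecayOn (Set.Icc (T - r ^ 2) (T - r ^ 2 / 2)) θ → (∀ t ∈ (Set.Icc (T - r ^ 2) (T - r ^ 2 / 2)), ∀ x : EuclideanSpace ℝ (Fin 3), Literature.Analysis.FluidPDE.timeDerivWithin (Set.Icc (T - r ^ 2) (T - r ^ 2 / 2)) θ t x + inner ℝ (u t x) (gradient (θ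 t) x) = Laplacian.laplacian (θ t) x) → Function.support (θ (T - r ^ 2)) ⊆ Metric.ball x₀ r → ∫ x, (θ (T - r ^ 2 / 2) x) ^ 2 ≤ δ ^ 2 * ∫ x, (θ (T - r ^ 2) x) ^ 2)) → False := by
  intro δ _hδ
  refine ⟨0, fun T hT u p hcl hLH hdec x₀ _hwin hunb _hrec => ?_⟩
  obtain ⟨M₁, r₁, hr₁, hC⟩ := cknC_ceiling_of_noTypeII hNT hT hcl hLH hdec x₀
  obtain ⟨r, hr, hlt⟩ := hunb M₁ r₁ hr₁
  exact absurd (hC r hr) (not_le.2 hlt)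

/-- **The registered stub `stub_coherentWindowExclusion` (regime I, verbatim, range `0 < δ < 1`) from
`NoTypeII`** (item stmt-NavierStokesRegularity-0056, by name as hypothesis): the instance `δ < 1` of
`coherentWindowRegime_of_noTypeII`. [folklore] -/
theorem stub_coherentWindowExclusion_of_noTypeII
    (hNT : Summit.NavierStokesRegularity.NavierStokesRegularity.Theses.TypeIIInviscidRelaxation.NoTypeII) :
    ∀ δ : ℝ, 0 < δ → δ < 1 → ∃ M : ℝ, ∀ T : ℝ, 0 < T → ∀ (u : ℝ → EuclideanSpace ℝ (Fin 3) → EuclideanSpace ℝ (Fin 3)) (p : ℝ → EuclideanSpace ℝ (Fin 3) → ℝ), Literature.Analysis.FluidPDE.IsClassicalNSSolutionOn (Set.Ico 0 T) 1 0 u p → Literature.Analysis.FluidPDE.IsLerayHopfOn T 1 0 (u 0) u → Literature.Analysis.FluidPDE.HasRapidSpatialDecay (u 0) → ∀ x₀ : EuclideanSpace ℝ (Fin 3), (∃ M' : ℝ, ∀ r₁ : ℝ, 0 < r₁ → ∃ r ∈ Set.Ioo 0 r₁, Literature.Analysis.FluidPDE.cknC r ((T, x₀) : ℝ × EuclideanSpace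 ℝ (Fin 3)) u ≤ ENNReal.ofReal M') → (∀ M'' r₁ : ℝ, 0 < r₁ → ∃ r ∈ Set.Ioo 0 r₁, ENNReal.ofReal M'' < Literature.Analysis.FluidPDE.cknC r ((T, x₀) : ℝ × EuclideanSpace ℝ (Fin 3)) u) → (∀ r₀ : ℝ, 0 < r₀ → ∃ r ∈ Set.Ioo 0 r₀, ENNReal.ofReal M ≤ Literature.Analysis.FluidPDE.cknC r ((T, x₀) : ℝ × EuclideanSpace ℝ (Fin 3)) u ∧ ¬ (∀ θ : ℝ → EuclideanSpace ℝ (Fin 3) → ℝ, Literature.Analysis.FluidPDE.IsSmoothSpaceTimeOn (Set.Icc (T - r ^ 2) (T - r ^ 2 / 2)) θ → Literature.Analysis.FluidPDE.HasUniformRapidDecayOn (Set.Icc (T - r ^ 2) (T - r ^ 2 / 2)) θ → (∀ t ∈ (Set.Icc (T - r ^ 2) (T - r ^ 2 / 2)), ∀ x : EuclideanSpace ℝ (Fin 3), Literature.Analysis.FluidPDE.timeDerivWithin (Set.Icc (T - r ^ 2) (T - r ^ 2 / 2)) θ t x + inner ℝ (u t x) (gradient (θ t) x) = Laplacian.laplacian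 (θ t) x) → Function.support (θ (T - r ^ 2)) ⊆ Metric.ball x₀ r → ∫ x, (θ (T - r ^ 2 / 2) x) ^ 2 ≤ δ ^ 2 * ∫ x, (θ (T - r ^ 2) x) ^ 2)) → False := by
  intro δ hδ _hδ1
  exact coherentWindowRegime_of_noTypeII hNT δ hδ

/-- **Regime (B) of the crux `CoherentScaleExclusion` — the statement of the core stub
`stub_coherentCascadeExclusion`, for EVERY `δ > 0` — follows from `NoTypeII`** (item stmt-NavierStokesRegularity-0056, by name as hypothesis),
without using the recurrence of non-`δ`-mixing scales: a pure cascade `C(r) → ∞` at `(T,x₀)` is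
incompatible with the load ceiling of `cknC_ceiling_of_noTypeII` (test the cascade at the level
`max M₁ 0 + 1`). So the stub that five line leads returned as crux-sized is DOMINATED BY A NAMED OPEN
ITEM of the summit, exactly as regimes (A) and (I) are dominated by S1. [folklore] -/
theorem coherentCascadeRegime_of_noTypeII
    (hNT : Summit.NavierStokesRegularity.NavierStokesRegularity.Theses.TypeIIInviscidRelaxation.NoTypeII) :
    ∀ δ : ℝ, 0 < δ → ∀ T : ℝ, 0 < T → ∀ (u : ℝ → EuclideanSpace ℝ (Fin 3) → EuclideanSpace ℝ (Fin 3)) (p : ℝ → EuclideanSpace ℝ (Fin 3) → ℝ), Literature.Analysis.FluidPDE.IsClassicalNSSolutionOn (Set.Ico 0 T) 1 0 u p → Literature.Analysis.FluidPDE.IsLerayHopfOn T 1 0 (u 0) u → Literature.Analysis.FluidPDE.HasRapidSpatialDecay (u 0) → ∀ x₀ : EuclideanSpace ℝ (Fin 3), (∀ M' : ℝ, ∃ r₁ : ℝ, 0 < r₁ ∧ ∀ r ∈ Set.Ioo 0 r₁, ENNReal.ofReal M' ≤ Literature.Analysis.FluidPDE.cknC r ((T, x₀) : ℝ × EuclideanSpace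 ℝ (Fin 3)) u) → (∀ r₀ : ℝ, 0 < r₀ → ∃ r ∈ Set.Ioo 0 r₀, ¬ (∀ θ : ℝ → EuclideanSpace ℝ (Fin 3) → ℝ, Literature.Analysis.FluidPDE.IsSmoothSpaceTimeOn (Set.Icc (T - r ^ 2) (T - r ^ 2 / 2)) θ → Literature.Analysis.FluidPDE.HasUniformRapidDecayOn (Set.Icc (T - r ^ 2) (T - r ^ 2 / 2)) θ → (∀ t ∈ (Set.Icc (T - r ^ 2) (T - r ^ 2 / 2)), ∀ x : EuclideanSpace ℝ (Fin 3), Literature.Analysis.FluidPDE.timeDerivWithin (Set.Icc (T - r ^ 2) (T - r ^ 2 / 2)) θ t x + inner ℝ (u t x) (gradient (θ t) x) = Laplacian.laplacian (θ t) x) → Function.support (θ (T - r ^ 2)) ⊆ Metric.ball x₀ r → ∫ x, (θ (T - r ^ 2 / 2) x) ^ 2 ≤ δ ^ 2 * ∫ x, (θ (T - r ^ 2) x) ^ 2)) → False := by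
  intro δ _hδ T hT u p hcl hLH hdec x₀ hcasc _hrec
  obtain ⟨M₁, r₁, hr₁, hC⟩ := cknC_ceiling_of_noTypeII hNT hT hcl hLH hdec x₀
  obtain ⟨r₂, hr₂, hM⟩ := hcasc (max M₁ 0 + 1)
  have hr : min r₁ r₂ / 2 ∈ Set.Ioo 0 (min r₁ r₂) := ⟨by positivity, by
    have := lt_min hr₁ hr₂; linarith⟩
  have h1 := hM _ ⟨hr.1, lt_of_lt_of_le hr.2 (min_le_right _ _)⟩
  have h2 := hC _ ⟨hr.1, lt_of_lt_of_le hr.2 (min_le_left _ _)⟩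
  have hlt : ENNReal.ofReal M₁ < ENNReal.ofReal (max M₁ 0 + 1) :=
    (ENNReal.ofReal_lt_ofReal_iff (by positivity)).2 (by
      have := le_max_left M₁ 0; linarith)
  exact absurd (h1.trans h2) (not_le.2 hlt)

/-- **The registered core stub `stub_coherentCascadeExclusion` (regime B, verbatim, range `0 < δ < 1`)
from `NoTypeII`** (item stmt-NavierStokesRegularity-0056, by name as hypothesis): the instance `δ < 1` of
`coherentCascadeRegime_of_noTypeII`. [folklore] -/
theorem stub_coherentCascadeExclusion_of_noTypeII
    (hNT : Summit.NavierStokesRegularity.NavierStokesRegularity.Theses.TypeIIInviscidRelaxation.NoTypeII) :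
    ∀ δ : ℝ, 0 < δ → δ < 1 → ∀ T : ℝ, 0 < T → ∀ (u : ℝ → EuclideanSpace ℝ (Fin 3) → EuclideanSpace ℝ (Fin 3)) (p : ℝ → EuclideanSpace ℝ (Fin 3) → ℝ), Literature.Analysis.FluidPDE.IsClassicalNSSolutionOn (Set.Ico 0 T) 1 0 u p → Literature.Analysis.FluidPDE.IsLerayHopfOn T 1 0 (u 0) u → Literature.Analysis.FluidPDE.HasRapidSpatialDecay (u 0) → ∀ x₀ : EuclideanSpace ℝ (Fin 3), (∀ M' : ℝ, ∃ r₁ : ℝ, 0 < r₁ ∧ ∀ r ∈ Set.Ioo 0 r₁, ENNReal.ofReal M' ≤ Literature.Analysis.FluidPDE.cknC r ((T, x₀) : ℝ × EuclideanSpace ℝ (Fin 3)) u) → (∀ r₀ : ℝ, 0 < r₀ → ∃ r ∈ Set.Ioo 0 r₀, ¬ (∀ θ : ℝ → EuclideanSpace ℝ (Fin 3) → ℝ, Literature.Analysis.FluidPDE.IsSmoothSpaceTimeOn (Set.Icc (T - r ^ 2) (T - r ^ 2 / 2)) θ → Literature.Analysis.FluidPDE.HasUniformRapidDecayOn (Set.Icc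 (T - r ^ 2) (T - r ^ 2 / 2)) θ → (∀ t ∈ (Set.Icc (T - r ^ 2) (T - r ^ 2 / 2)), ∀ x : EuclideanSpace ℝ (Fin 3), Literature.Analysis.FluidPDE.timeDerivWithin (Set.Icc (T - r ^ 2) (T - r ^ 2 / 2)) θ t x + inner ℝ (u t x) (gradient (θ t) x) = Laplacian.laplacian (θ t) x) → Function.support (θ (T - r ^ 2)) ⊆ Metric.ball x₀ r → ∫ x, (θ (T - r ^ 2 / 2) x) ^ 2 ≤ δ ^ 2 * ∫ x, (θ (T - r ^ 2) x) ^ 2)) → False := by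
  intro δ hδ _hδ1
  exact coherentCascadeRegime_of_noTypeII hNT δ hδ

/-! ### Consequences for the crux and for the route -/

/-- **`NoTypeII ∧ S1 ⇒ S2`.** Feed `coherentScaleExclusion_of_regimes` with regime (A) from S1
(`coherentTypeIRegime_of_sequentialTypeIExclusion`) and regimes (I), (B) from `NoTypeII`. Both
antecedents are named open items (stmt-0056, stmt-1424); together they already prove the summit
(`navierStokesRegularity_of_sequentialTypeIExclusion_of_noTypeII`), so the informative dominations are
the per-regime ones above. [folklore] -/
theorem coherentScaleExclusion_of_noTypeII_of_sequentialTypeIExclusion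
    (hNT : Summit.NavierStokesRegularity.NavierStokesRegularity.Theses.TypeIIInviscidRelaxation.NoTypeII)
    (hS1 : SequentialTypeIExclusion) : CoherentScaleExclusion :=
  coherentScaleExclusion_of_regimes (coherentTypeIRegime_of_sequentialTypeIExclusion hS1)
    (coherentWindowRegime_of_noTypeII hNT) (coherentCascadeRegime_of_noTypeII hNT)

/-- **`NoTypeII ∧ ¬TypeISingularityExists ⇒ S2`.** The same composition with regime (A) supplied by
the centred local Type-I exclusion `¬ TypeISingularityExists`
(`coherentTypeIRegime_of_not_typeISingularityExists`). [folklore] -/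
theorem coherentScaleExclusion_of_noTypeII_of_not_typeISingularityExists
    (hNT : Summit.NavierStokesRegularity.NavierStokesRegularity.Theses.TypeIIInviscidRelaxation.NoTypeII)
    (hX : ¬ Literature.Analysis.FluidPDE.TypeISingularityExists) : CoherentScaleExclusion :=
  coherentScaleExclusion_of_regimes (coherentTypeIRegime_of_not_typeISingularityExists hX)
    (coherentWindowRegime_of_noTypeII hNT) (coherentCascadeRegime_of_noTypeII hNT)

/-- **S1 bars every `L∞`-Type-I blow-up: backward boundedness.** If `SequentialTypeIExclusion` holds,
a standing solution with the `L∞` Type-I rate at `T` is bounded near EVERY `(T,x₀)`: the rate gives a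
centred cubic ceiling at `x₀` (`cknC_ceiling_of_isTypeIBlowup`), hence the bounded-load scales are
cofinal, and S1 concludes. (File `…NonMixingExclusion` derived this from S1 ∧ S2; S2 is not needed.)
[folklore] -/
theorem isBackwardBoundedAt_of_isTypeIBlowup_of_sequentialTypeIExclusion
    (hS1 : SequentialTypeIExclusion) {T : ℝ} (hT : 0 < T)
    {u : ℝ → EuclideanSpace ℝ (Fin 3) → EuclideanSpace ℝ (Fin 3)} {p : ℝ → EuclideanSpace ℝ (Fin 3) → ℝ}
    (hcl : IsClassicalNSSolutionOn (Set.Ico 0 T) 1 0 u p) (hLH : IsLerayHopfOn T 1 0 (u 0) u)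
    (hdec : HasRapidSpatialDecay (u 0)) (hI : IsTypeIBlowup u T) (x₀ : EuclideanSpace ℝ (Fin 3)) :
    IsBackwardBoundedAt u T x₀ := by
  obtain ⟨M₁, r₁, hr₁, hC⟩ := cknC_ceiling_of_isTypeIBlowup hT hcl hLH hdec hI x₀
  obtain ⟨ρ, hρ, M, hM⟩ := hS1 M₁ T hT u p hcl hLH hdec x₀ fun r₀ hr₀ =>
    ⟨min r₀ r₁ / 2, ⟨by positivity, by linarith [min_le_left r₀ r₁, lt_min hr₀ hr₁]⟩,
      hC _ ⟨by positivity, by linarith [min_le_right r₀ r₁, lt_min hr₀ hr₁]⟩⟩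
  exact ⟨ρ, hρ, M, hM⟩

/-- **S1 bars every `L∞`-Type-I blow-up: continuation** (the `ν = 1` instance of `NoTypeIBlowup`,
item stmt-NavierStokesRegularity-1217, from S1 alone). A standing solution with the `L∞` Type-I rate
at `T` extends smoothly past `T`: backward boundedness at every point of the final slice
(`isBackwardBoundedAt_of_isTypeIBlowup_of_sequentialTypeIExclusion`) and the continuation of bounded
Leray–Hopf solutions (`selfMixingDichotomy_hasSmoothExtensionPast_of_isBackwardBoundedAt`, route glue
of `LocalToGlobal`). [folklore] -/
theorem hasSmoothExtensionPast_of_isTypeIBlowup_of_sequentialTypeIExclusion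
    (hS1 : SequentialTypeIExclusion) {T : ℝ} (hT : 0 < T)
    {u : ℝ → EuclideanSpace ℝ (Fin 3) → EuclideanSpace ℝ (Fin 3)} {p : ℝ → EuclideanSpace ℝ (Fin 3) → ℝ}
    (hcl : IsClassicalNSSolutionOn (Set.Ico 0 T) 1 0 u p) (hLH : IsLerayHopfOn T 1 0 (u 0) u)
    (hdec : HasRapidSpatialDecay (u 0)) (hI : IsTypeIBlowup u T) :
    HasSmoothExtensionPast 1 0 u T :=
  selfMixingDichotomy_hasSmoothExtensionPast_of_isBackwardBoundedAt one_pos hT hcl hLH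
    (isBackwardBoundedAt_of_isTypeIBlowup_of_sequentialTypeIExclusion hS1 hT hcl hLH hdec hI)

/-- **The `L∞` Type-I rate is preserved by the viscosity normalisation.** If `u` blows up at most
at the Type-I rate at `T`, `‖u(t,x)‖ ≤ C/√(T−t)` near `T`, then the unit-viscosity rescaling
`v(s,x) = ν⁻¹ u(s/ν, x)` (`timeRescale ν⁻¹ ν⁻¹ u`) satisfies `‖v(s,x)‖ ≤ √(ν⁻¹) C₊/√(νT − s)` near `νT`
(`C₊ = max C 0`; `T − s/ν = ν⁻¹ (νT − s)`). [folklore] -/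
theorem isTypeIBlowup_timeRescale {ν T : ℝ} (hν : 0 < ν)
    {u : ℝ → EuclideanSpace ℝ (Fin 3) → EuclideanSpace ℝ (Fin 3)} (h : IsTypeIBlowup u T) :
    IsTypeIBlowup (timeRescale ν⁻¹ ν⁻¹ u) (ν * T) := by
  obtain ⟨C, hC⟩ := h
  have hν0 : ν ≠ 0 := hν.ne'
  have hνi : 0 < ν⁻¹ := inv_pos.2 hν
  -- `s ↦ ν⁻¹ s` maps `𝓝[<] (νT)` to `𝓝[<] T`
  have hmaps : MapsTo (fun s : ℝ => ν⁻¹ * s) (Iio (ν * T)) (Iio T) := by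
    intro s hs
    calc ν⁻¹ * s < ν⁻¹ * (ν * T) := mul_lt_mul_of_pos_left hs hνi
      _ = T := by rw [← mul_assoc, inv_mul_cancel₀ hν0, one_mul]
  have htend : Tendsto (fun s : ℝ => ν⁻¹ * s) (𝓝[<] (ν * T)) (𝓝[<] T) := by
    have hcont : ContinuousWithinAt (fun s : ℝ => ν⁻¹ * s) (Iio (ν * T)) (ν * T) :=
      (continuous_const.mul continuous_id).continuousWithinAt
    have := hcont.tendsto_nhdsWithin hmaps
    rwa [← mul_assoc, inv_mul_cancel₀ hν0, one_mul] at this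
  refine ⟨Real.sqrt ν⁻¹ * max C 0, ?_⟩
  filter_upwards [htend.eventually hC, self_mem_nhdsWithin] with s hs hsT x
  have hsT' : 0 < ν * T - s := sub_pos.2 hsT
  have hTs : T - ν⁻¹ * s = ν⁻¹ * (ν * T - s) := by field_simp
  have hpos : 0 < T - ν⁻¹ * s := by rw [hTs]; positivity
  have hsq : Real.sqrt (T - ν⁻¹ * s) = Real.sqrt ν⁻¹ * Real.sqrt (ν * T - s) := by
    rw [hTs, Real.sqrt_mul hνi.le]
  have h1 : ‖u (ν⁻¹ * s) x‖ ≤ max C 0 / Real.sqrt (T - ν⁻¹ * s) :=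
    (hs x).trans (div_le_div_of_nonneg_right (le_max_left _ _) (Real.sqrt_nonneg _))
  have hsi : 0 < Real.sqrt ν⁻¹ := Real.sqrt_pos.2 hνi
  have hsνT : 0 < Real.sqrt (ν * T - s) := Real.sqrt_pos.2 hsT'
  rw [timeRescale_apply, norm_smul, Real.norm_eq_abs, abs_of_pos hνi]
  calc ν⁻¹ * ‖u (ν⁻¹ * s) x‖ ≤ ν⁻¹ * (max C 0 / Real.sqrt (T - ν⁻¹ * s)) :=
        mul_le_mul_of_nonneg_left h1 hνi.le
    _ = ν⁻¹ * (max C 0 / (Real.sqrt ν⁻¹ * Real.sqrt (ν * T - s))) := by rw [hsq]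
    _ = Real.sqrt ν⁻¹ * max C 0 / Real.sqrt (ν * T - s) := by
        have haa : Real.sqrt ν⁻¹ * Real.sqrt ν⁻¹ = ν⁻¹ := Real.mul_self_sqrt hνi.le
        generalize Real.sqrt ν⁻¹ = a at haa hsi ⊢
        rw [← haa]
        field_simp

/-- **S1 implies `NoTypeIBlowup`** (item stmt-NavierStokesRegularity-1217 of routes
`TypeIIInviscidRelaxation` / `TypeILiouville`, by name): under `SequentialTypeIExclusion`, for EVERY
viscosity `ν > 0`, a classical Leray–Hopf solution from a rapidly decaying datum which blows up at most
at the `L∞` Type-I rate extends smoothly past `T`. Viscosity normalisation as in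
`selfMixingDichotomy_isBackwardBoundedAt_of_unitViscosity` (Tao 2011, footnote 3): the rescaled
`v(s,x) = ν⁻¹u(s/ν,x)` is a standing `ν = 1` solution on `[0, νT)` with the Type-I rate
(`isTypeIBlowup_timeRescale`), hence backward bounded at every `(νT, x₀)`
(`isBackwardBoundedAt_of_isTypeIBlowup_of_sequentialTypeIExclusion`); the bound transports back to `u`
on the radius `r / max 1 ν`, and bounded Leray–Hopf solutions continue
(`selfMixingDichotomy_hasSmoothExtensionPast_of_isBackwardBoundedAt`). So the crux S1 (stmt-1424)
DOMINATES the shared Type-I exclusion item. [folklore] -/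
theorem noTypeIBlowup_of_sequentialTypeIExclusion (hS1 : SequentialTypeIExclusion) :
    Summit.NavierStokesRegularity.NavierStokesRegularity.Theses.TypeIIInviscidRelaxation.NoTypeIBlowup := by
  intro ν T hν hT u p hs hLH hd hI
  refine selfMixingDichotomy_hasSmoothExtensionPast_of_isBackwardBoundedAt hν hT hs hLH fun x₀ => ?_
  have hν0 : ν ≠ 0 := hν.ne'
  have hνi : 0 < ν⁻¹ := inv_pos.2 hν
  have hνT : 0 < ν * T := mul_pos hν hT
  -- the rescaled pair at viscosity `1` on `[0, νT)`
  set v : ℝ → EuclideanSpace ℝ (Fin 3) → EuclideanSpace ℝ (Fin 3) := timeRescale ν⁻¹ ν⁻¹ u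
    with hv
  set π : ℝ → EuclideanSpace ℝ (Fin 3) → ℝ := timeRescale ν⁻¹ (ν⁻¹ ^ 2) p with hπ
  have hslice : ∀ s, v s = ν⁻¹ • u (ν⁻¹ * s) := fun s => rfl
  have hmaps : MapsTo (fun s => ν⁻¹ * s) (Ico 0 (ν * T)) (Ico 0 T) := by
    intro s hs'
    refine ⟨mul_nonneg hνi.le hs'.1, ?_⟩
    calc ν⁻¹ * s < ν⁻¹ * (ν * T) := mul_lt_mul_of_pos_left hs'.2 hνi
      _ = T := by rw [← mul_assoc, inv_mul_cancel₀ hν0, one_mul]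
  have hs' : IsClassicalNSSolutionOn (Ico 0 (ν * T)) 1 0 v π := by
    have := hs.viscosityRescale_set hν0 hmaps (uniqueDiffOn_Ico 0 (ν * T))
    rwa [timeRescale_zero_force] at this
  have hv0 : v 0 = ν⁻¹ • u 0 := by rw [hslice, mul_zero]
  have hLH' : IsLerayHopfOn (ν * T) 1 0 (v 0) v := by
    have := hLH.viscosityRescale hνi
    rw [div_inv_eq_mul, mul_comm T ν, inv_mul_cancel₀ hν0, timeRescale_zero_force] at this
    rwa [hv0]
  have hd' : HasRapidSpatialDecay (v 0) := by
    rw [hv0]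
    exact SereginSverak2002_pressureOneSidedBound.hasRapidSpatialDecay_const_smul
      (hs.contDiff_velocity ⟨le_rfl, hT⟩) hd ν⁻¹
  have hI' : IsTypeIBlowup v (ν * T) := isTypeIBlowup_timeRescale hν hI
  -- backward boundedness of `v` at `(ν T, x₀)` from S1
  obtain ⟨r, hr, C, hC⟩ :=
    isBackwardBoundedAt_of_isTypeIBlowup_of_sequentialTypeIExclusion hS1 hνT hs' hLH' hd' hI' x₀
  -- transport back: radius `r' = r / max 1 ν`
  set m : ℝ := max 1 ν with hm
  have hm1 : 1 ≤ m := le_max_left _ _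
  have hmν : ν ≤ m := le_max_right _ _
  have hm0 : 0 < m := by positivity
  refine ⟨r / m, by positivity, ν * C, fun t ht x hx => ?_⟩
  have hrm : r / m ≤ r := div_le_self hr.le hm1
  have hts : ν * t ∈ Ioo (ν * T - r ^ 2) (ν * T) := by
    constructor
    · have h1 : ν * (T - t) < ν * (r / m) ^ 2 := mul_lt_mul_of_pos_left (by linarith [ht.1]) hν
      have hsq : ν * (r / m) ^ 2 ≤ r ^ 2 := by
        rw [div_pow]
        have hm2 : ν ≤ m ^ 2 := hmν.trans (by nlinarith)
        calc ν * (r ^ 2 / m ^ 2) = ν / m ^ 2 * r ^ 2 := by ring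
          _ ≤ 1 * r ^ 2 := by
              refine mul_le_mul_of_nonneg_right ?_ (sq_nonneg r)
              rw [div_le_one (by positivity)]; exact hm2
          _ = r ^ 2 := one_mul _
      nlinarith
    · exact mul_lt_mul_of_pos_left ht.2 hν
  have hxs : x ∈ ball x₀ r := ball_subset_ball hrm hx
  have key := hC (ν * t) hts x hxs
  rw [hslice, Pi.smul_apply, ← mul_assoc, inv_mul_cancel₀ hν0, one_mul, norm_smul,
    Real.norm_eq_abs, abs_of_pos hνi] at key
  exact (inv_mul_le_iff₀ hν).1 key

/-- **`S1 ∧ NoTypeII ⇒ NavierStokesRegularity`.** Modulo the sibling crux S1 the pair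
(`MixingPayoff`, `CoherentScaleExclusion`) of this route can be replaced by the Type-II exclusion
statement `NoTypeII` (item stmt-NavierStokesRegularity-0056, by name as hypothesis): every `ν = 1`
standing solution is backward bounded at every final-time point — if it extends past `T` by
`isBackwardBoundedAt_of_hasSmoothExtensionPast`, if it is maximal by `NoTypeII` (Type-I rate),
`cknC_ceiling_of_isTypeIBlowup` and S1 — so `LocalToGlobal` (`selfMixingDichotomy_localToGlobal_proof`)
gives `NoBlowup` for every `ν > 0` and `NoBlowupToClay_holds` gives Clay (A). [folklore] -/
theorem navierStokesRegularity_of_sequentialTypeIExclusion_of_noTypeII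
    (hS1 : SequentialTypeIExclusion)
    (hNT : Summit.NavierStokesRegularity.NavierStokesRegularity.Theses.TypeIIInviscidRelaxation.NoTypeII) :
    NavierStokesRegularity := by
  refine NoBlowupToClay_holds (selfMixingDichotomy_localToGlobal_proof ?_)
  intro T hT u p hcl hLH hdec x₀
  by_cases hext : HasSmoothExtensionPast 1 0 u T
  · obtain ⟨ρ, hρ, K, hK⟩ :=
      PlaneEnergyCeilingBoundedPlanarEnergyRegularity.isBackwardBoundedAt_of_hasSmoothExtensionPast hT hext x₀
    exact ⟨ρ, hρ, K, hK⟩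
  · obtain ⟨ρ, hρ, K, hK⟩ := isBackwardBoundedAt_of_isTypeIBlowup_of_sequentialTypeIExclusion hS1 hT
      hcl hLH hdec (hNT 1 T one_pos hT u p ⟨hcl, hext⟩ hLH hdec) x₀
    exact ⟨ρ, hρ, K, hK⟩

end Summit.NavierStokesRegularity.NavierStokesRegularity.Theorems

end
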